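import Summits.CriticalPhenomena.PercolationContinuityZ3.Theorems.Transplant.SkelPhiStemQ
import Summits.CriticalPhenomena.PercolationContinuityZ3.Theorems.Transplant.SkelPhiSideForm
import Summits.CriticalPhenomena.PercolationContinuityZ3.Theorems.Transplant.SkelPhiSeedSlabKit
import HarnessLib

/-!
# N1 (the `{±1}` node), LEVEL 1, kit adapter file N-K4c: THE APRON KIT GEOMETRY OF A WINDOW LEVEL — DEFINITIONS AND FOOTPRINTS.  Two maps: the WINDOW
# map `ψ` (levels, contacts, wired path; quasi-steps of cost `N`) and the BASE chart `φ` (apron, kit centre, short region; unit steps).  Per contact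
# `x` of the level box `Icc Lo Hi`: inner neighbour `y`, exit datum `(i₀, σ₀)`, wired `ψ`-path to the stem end `t₁` (depth `1 + d`), the apron of
# `φ` about `t₁` below the shell line of the side `(i₀, σ₀)`, the kit centre `c` above it, the pinned short region `Qk = Rg c ∩ shell window` and
# the face `U x` = its vertices adjacent to the apron; `Skelφ.apronGeom` packs this as a `KitGeom` (near contacts; far contacts: `{y}` as in D″)

builds on p205010 (kernel theorem, internal audit signed; external expert review pending) — nothing in this file uses p205010; nothing here is a
claim about the open node `SamePDropOfSkeletonNeg`.
Lane `prim-bschramm`, seat `prim-bschramm-p1` (gen 11; design KIT-APRON-N1, lane INBOX 2026-08-21 13:56Z; no objection lead g6 14:20Z, hp-8 14:03Z);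
helper file (`--supports stmt-CriticalPhenomena-4575 --as helper`).
* §1 `ApronPrm` (the integer parameters), `shellD` (`= 2ℓs + 2`), `shellWinA`, the contact data `ctY/ctDir/ctT1/ctWire/ctApron/ctCtr/ctQk/ctFace`,
  **`apronGeom`**;
* §2 footprints in the window: `sdepth_stemPtQ`, `ψ_stemPtQ_exit_mem`, `ψ_pathPtQ_tan` (twin of `φ_pathPt_tan`), `mem_Icc_of_mem_wireFinQ`, `ctDir_face`,
  `ctY_mem_Icc`, `sdepth_ctY_eq_zero`, `ψ_ctT1`, **`mem_Icc_of_mem_ctWire`** (wired path in the box), `ctT1_mem_graphBall`, `ctWire_subset_graphBall'`;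
* §3 the kit centre: `φ_ctCtr`, `le_lin_ctCtr`, `ctCtr_mem_graphBall`; the face: `ctFace_subset_ctQk`, `exists_adj_of_mem_ctFace`.
[cite: KozmaNitzan2024, §4 Lemma 10, pp. 19–21 (Step III: seeds, v(P), U(P), "Q ⊆ S")] [cite: MartineauTassion2017, §4.3]
-/

noncomputable section

open scoped Classical

namespace Summit.CriticalPhenomena.PercolationContinuityZ3.Theorems.Transplant

namespace Skelφ

open Literature.Probability.Percolation Literature.Probability.LatticeModels SimpleGraph KNLevels
open Literature.Probability.Percolation.KozmaNitzan.Cells (oth oth_ne eq_oth_of_ne oth_oth)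
open Literature.Barriers.CriticalPhenomena (graphBall graphBall_finite mem_graphBall_self graphBall_mono)
open Skel (winGraph winGraph_adj KitGeom)
open SkelI (slabPt tanOff tanTgt tanTgt_mem natAbs_tanTgt_sub_le tanSign natAbs_mul_tanSign)

variable {V : Type} [DecidableEq V]

/-! ## §1 Parameters and the contact data -/

/-- **The integer parameters of the apron kit.** [this work] -/
structure ApronPrm where
  /-- quasi-step cost of the window map -/
  N : ℕ
  /-- shell half-depth: the pinned shell starts at depth `2ℓs + 2` -/
  ℓs : ℕ
  /-- tangential clamp surplus (`T₀ = tanOff ℓs M = 2ℓs + 2 + M`) -/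
  M : ℕ
  /-- stem length: the stem end sits at depth `1 + d` -/
  d : ℕ
  /-- apron half-width -/
  W : ℕ
  /-- apron thickness (fat-prism half-width, `≥ 1`) -/
  ℓ : ℕ
  /-- fat-prism radius -/
  R' : ℕ
  /-- offset of the kit centre above the shell line -/
  A : ℤ
  /-- near/far threshold -/
  r₀ : ℕ

/-- The shell depth `D = 2ℓs + 2`. [folklore] -/
def shellD (P : ApronPrm) : ℕ := 2 * P.ℓs + 2

variable (G : SimpleGraph V) (ψ φ : V → Site 2)

/-- The inner neighbour of a contact. [folklore] -/
def ctY (w₀ : V) (R : ℕ) (Lo Hi : Site 2) (x : V) : V := inNbr G ψ w₀ R (Finset.Icc Lo Hi) x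

/-- The exit datum of a contact. [folklore] -/
def ctDir (w₀ : V) (R : ℕ) (Lo Hi : Site 2) (x : V) : Fin 2 × ℤˣ := exitDir G ψ w₀ R Lo Hi x

/-- **The stem end `t₁`** of a contact (depth `1 + d` behind its exit side, tangential coordinate clamped). [this work] -/
def ctT1 (P : ApronPrm) (w₀ : V) (R : ℕ) (Lo Hi : Site 2) (x : V) : V :=
  stemPtQ G ψ P.N Lo Hi P.ℓs P.M (ctDir G ψ w₀ R Lo Hi x).1 (ctDir G ψ w₀ R Lo Hi x).2 (ctY G ψ w₀ R Lo Hi x) P.d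

/-- **The wired `ψ`-path** of a contact. [this work] -/
def ctWire (P : ApronPrm) (w₀ : V) (R : ℕ) (Lo Hi : Site 2) (x : V) : Finset V :=
  wireFinQ G ψ P.N Lo Hi P.ℓs P.M (ctDir G ψ w₀ R Lo Hi x).1 (ctDir G ψ w₀ R Lo Hi x).2 (ctY G ψ w₀ R Lo Hi x) P.d

variable [G.LocallyFinite]

/-- **The shell window** of the level box `Icc Lo Hi`: the window over the box shrunk by `D = 2ℓs + 2` (the first part of `pinSet`). [folklore] -/
def shellWinA (w₀ : V) (R : ℕ) (Lo Hi : Site 2) (ℓs : ℕ) : Finset V :=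
  Win G ψ w₀ (Finset.Icc (Lo + ((2 * ℓs + 2 : ℕ) : Site 2)) (Hi - ((2 * ℓs + 2 : ℕ) : Site 2))) R

variable {ψ φ}

/-- **The apron** of a contact: the base-chart apron about `t₁` for the side form of its exit side, height profile below the shell line. [this work] -/
def ctApron {Lo Hi : Site 2} (SF : ∀ (i : Fin 2) (σ : ℤˣ), SideForm ψ φ Lo Hi i σ) (P : ApronPrm) (w₀ : V) (R : ℕ) (x : V) : Finset V :=
  apronFin G φ (ctT1 G ψ P w₀ R Lo Hi x) (SF (ctDir G ψ w₀ R Lo Hi x).1 (ctDir G ψ w₀ R Lo Hi x).2).a (SF (ctDir G ψ w₀ R Lo Hi x).1 (ctDir G ψ w₀ R Lo Hi x).2).s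
    P.W ((SF (ctDir G ψ w₀ R Lo Hi x).1 (ctDir G ψ w₀ R Lo Hi x).2).apronK (φ (ctT1 G ψ P w₀ R Lo Hi x)) (shellD P) P.ℓ) P.ℓ P.R'

/-- **The kit centre** of a contact: the base-chart column vertex over the kit point above the shell line. [this work] -/
def ctCtr {Lo Hi : Site 2} (SF : ∀ (i : Fin 2) (σ : ℤˣ), SideForm ψ φ Lo Hi i σ) (P : ApronPrm) (w₀ : V) (R : ℕ) (x : V) : V :=
  colPt G φ (ctT1 G ψ P w₀ R Lo Hi x) ((SF (ctDir G ψ w₀ R Lo Hi x).1 (ctDir G ψ w₀ R Lo Hi x).2).kitPt (φ (ctT1 G ψ P w₀ R Lo Hi x)) (shellD P) P.A)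

/-- **The pinned short region** of a contact: `Rg c ∩ shell window`. [this work] -/
def ctQk {Lo Hi : Site 2} (SF : ∀ (i : Fin 2) (σ : ℤˣ), SideForm ψ φ Lo Hi i σ) (Rg : V → Finset V) (P : ApronPrm) (w₀ : V) (R : ℕ) (x : V) :
    Finset V :=
  Rg (ctCtr G SF P w₀ R x) ∩ shellWinA G ψ w₀ R Lo Hi P.ℓs

/-- **The face** of a contact: the vertices of its pinned short region adjacent to its apron. [this work] -/
def ctFace {Lo Hi : Site 2} (SF : ∀ (i : Fin 2) (σ : ℤˣ), SideForm ψ φ Lo Hi i σ) (Rg : V → Finset V) (P : ApronPrm) (w₀ : V) (R : ℕ) (x : V) :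
    Finset V :=
  (ctQk G SF Rg P w₀ R x).filter fun u => ∃ w ∈ ctApron G SF P w₀ R x, G.Adj w u

/-- **The apron kit geometry** of the window level (`Lo = lo − j`, `Hi = hi + j`): NEAR contact (`y ∈ B_G(w₀, R − r₀)`): region = wired path ∪ apron,
face = `ctFace`; FAR contact: region and face `{y}` (edge-contact remedy). [this work] -/
def apronGeom {Lo Hi : Site 2} (SF : ∀ (i : Fin 2) (σ : ℤˣ), SideForm ψ φ Lo Hi i σ) (Rg : V → Finset V) (P : ApronPrm) (w₀ : V) (R : ℕ) :
    KitGeom V where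
  y := ctY G ψ w₀ R Lo Hi
  S := fun x => if ctY G ψ w₀ R Lo Hi x ∈ graphBall G w₀ (R - P.r₀) then ctWire G ψ P w₀ R Lo Hi x ∪ ctApron G SF P w₀ R x
    else {ctY G ψ w₀ R Lo Hi x}
  U := fun x => if ctY G ψ w₀ R Lo Hi x ∈ graphBall G w₀ (R - P.r₀) then ctFace G SF Rg P w₀ R x else {ctY G ψ w₀ R Lo Hi x}

/-! ## §2 Footprints in the window -/

section Footprints

variable {G} {w₀ : V} {R : ℕ} {Lo Hi : Site 2}

omit [DecidableEq V] [G.LocallyFinite] in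
/-- **The stem behind a face**: if `y` sits on the face `(i₀, σ₀)` (`σ₀ = 1 ∧ ψ y i₀ = Hi i₀`, or `σ₀ = −1 ∧ ψ y i₀ = Lo i₀`; box side `≥ 2` in `i₀`,
`ψ y` in the box) then `stemPt k` sits at depth exactly `1 + k`. [folklore] -/
theorem sdepth_stemPtQ {N : ℕ} (hq : QStepsN G ψ N) {ℓs M : ℕ} {i₀ : Fin 2} {σ₀ : ℤˣ} (hw2 : Lo i₀ + 2 ≤ Hi i₀) {y : V}
    (hy : ψ y ∈ Finset.Icc Lo Hi) (hface : (σ₀ = 1 ∧ ψ y i₀ = Hi i₀) ∨ (σ₀ = -1 ∧ ψ y i₀ = Lo i₀)) (k : ℕ) :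
    sdepth ψ Lo Hi i₀ σ₀ (stemPtQ G ψ N Lo Hi ℓs M i₀ σ₀ y k) = 1 + k := by
  have h := (ψ_stemPtQ_coords hq (ℓs := ℓs) (M := M) i₀ hw2 σ₀ hy k).1
  unfold sdepth
  rw [h]
  rcases hface with ⟨hs, hc⟩ | ⟨hs, hc⟩
  · subst hs
    have hsl : slabPt Lo Hi 1 (ψ y) i₀ = Hi i₀ - 1 := by
      simp only [slabPt, Nat.cast_one]; rw [hc]; simp only [max_def, min_def]; split_ifs <;> omega
    rw [hsl, Units.val_one, if_pos rfl]; ring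
  · subst hs
    have hsl : slabPt Lo Hi 1 (ψ y) i₀ = Lo i₀ + 1 := by
      simp only [slabPt, Nat.cast_one]; rw [hc]; simp only [max_def, min_def]; split_ifs <;> omega
    rw [hsl, Units.val_neg, Units.val_one, if_neg (by norm_num)]; ring

omit [DecidableEq V] [G.LocallyFinite] in
/-- The exit coordinate along the stem behind a face lies in `[Lo i₀ + 1, Hi i₀ − 1]` for `k ≤ d`, box side `≥ d + 2` in `i₀`. [folklore] -/
theorem ψ_stemPtQ_exit_mem {N : ℕ} (hq : QStepsN G ψ N) {ℓs M d : ℕ} {i₀ : Fin 2} {σ₀ : ℤˣ} (hdw : Lo i₀ + (d + 2 : ℕ) ≤ Hi i₀) {y : V}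
    (hy : ψ y ∈ Finset.Icc Lo Hi) (hface : (σ₀ = 1 ∧ ψ y i₀ = Hi i₀) ∨ (σ₀ = -1 ∧ ψ y i₀ = Lo i₀)) {k : ℕ} (hk : k ≤ d) :
    Lo i₀ + 1 ≤ ψ (stemPtQ G ψ N Lo Hi ℓs M i₀ σ₀ y k) i₀ ∧ ψ (stemPtQ G ψ N Lo Hi ℓs M i₀ σ₀ y k) i₀ ≤ Hi i₀ - 1 := by
  have hw2 : Lo i₀ + 2 ≤ Hi i₀ := by push_cast at hdw; omega
  have h := (ψ_stemPtQ_coords hq (ℓs := ℓs) (M := M) i₀ hw2 σ₀ hy k).1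
  rw [h]
  have hkd : (k : ℤ) ≤ d := by exact_mod_cast hk
  push_cast at hdw
  rcases hface with ⟨hs, hc⟩ | ⟨hs, hc⟩
  · subst hs
    have hsl : slabPt Lo Hi 1 (ψ y) i₀ = Hi i₀ - 1 := by
      simp only [slabPt, Nat.cast_one]; rw [hc]; simp only [max_def, min_def]; split_ifs <;> omega
    rw [hsl, Units.val_one]; constructor <;> linarith
  · subst hs
    have hsl : slabPt Lo Hi 1 (ψ y) i₀ = Lo i₀ + 1 := by
      simp only [slabPt, Nat.cast_one]; rw [hc]; simp only [max_def, min_def]; split_ifs <;> omega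
    rw [hsl, Units.val_neg, Units.val_one]; constructor <;> linarith

omit [DecidableEq V] [G.LocallyFinite] in
/-- The tangential coordinate along the quasi-path (`k ≤ K`): inside `[Lo i₁, Hi i₁]`, and in the interior from the first step on. Twin of
`φ_pathPt_tan`. [folklore] -/
theorem ψ_pathPtQ_tan {N : ℕ} (hq : QStepsN G ψ N) {ℓs M : ℕ} (i₀ : Fin 2) (hw2 : Lo i₀ + 2 ≤ Hi i₀) (hw : Lo (oth i₀) + 2 * tanOff ℓs M ≤ Hi (oth i₀))
    {y : V} (hy : ψ y ∈ Finset.Icc Lo Hi) {k : ℕ} (hk : k ≤ pathLen ψ Lo Hi ℓs M i₀ y) :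
    Lo (oth i₀) ≤ ψ (pathPtQ G ψ N Lo Hi ℓs M i₀ y k) (oth i₀) ∧ ψ (pathPtQ G ψ N Lo Hi ℓs M i₀ y k) (oth i₀) ≤ Hi (oth i₀) ∧
      (1 ≤ k → Lo (oth i₀) + 1 ≤ ψ (pathPtQ G ψ N Lo Hi ℓs M i₀ y k) (oth i₀) ∧ ψ (pathPtQ G ψ N Lo Hi ℓs M i₀ y k) (oth i₀) ≤ Hi (oth i₀) - 1) := by
  rw [(ψ_pathPtQ hq i₀ hw2 hy k).2]
  have hτ := tanTgt_mem (oth i₀) hw (ψ y)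
  have hyb := hy; rw [Finset.mem_Icc] at hyb
  have h1 : Lo (oth i₀) ≤ ψ y (oth i₀) := hyb.1 _
  have h2 : ψ y (oth i₀) ≤ Hi (oth i₀) := hyb.2 _
  have hT : 1 ≤ tanOff ℓs M := by unfold tanOff; omega
  unfold pathLen at hk
  set e := tanTgt Lo Hi ℓs M (oth i₀) (ψ y) - ψ y (oth i₀) with he
  unfold tanSign
  by_cases hd0 : 0 ≤ e
  · rw [if_pos hd0, Units.val_one, mul_one]
    have hk' : (k : ℤ) ≤ e := by have := Int.natAbs_of_nonneg hd0; omega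
    refine ⟨by omega, by omega, fun hk1 => ⟨by omega, by omega⟩⟩
  · rw [if_neg hd0, Units.val_neg, Units.val_one, mul_neg, mul_one]
    have hk' : (k : ℤ) ≤ -e := by have := Int.ofNat_natAbs_of_nonpos (le_of_lt (not_le.1 hd0)); omega
    refine ⟨by omega, by omega, fun hk1 => ⟨by omega, by omega⟩⟩

omit [G.LocallyFinite] in
/-- **The wired path behind a face lies in the level box** (box sides `≥ 2T₀` and `≥ d + 2` in the exit coordinate). [folklore] -/
theorem mem_Icc_of_mem_wireFinQ {N : ℕ} (hq : QStepsN G ψ N) {ℓs M d : ℕ} (hwide : ∀ i, Lo i + 2 * tanOff ℓs M ≤ Hi i)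
    (hdw : ∀ i, Lo i + (d + 2 : ℕ) ≤ Hi i) {i₀ : Fin 2} {σ₀ : ℤˣ} {y : V} (hy : ψ y ∈ Finset.Icc Lo Hi)
    (hface : (σ₀ = 1 ∧ ψ y i₀ = Hi i₀) ∨ (σ₀ = -1 ∧ ψ y i₀ = Lo i₀)) {v : V} (hv : v ∈ wireFinQ G ψ N Lo Hi ℓs M i₀ σ₀ y d) :
    ψ v ∈ Finset.Icc Lo Hi := by
  have hw2 : ∀ i, Lo i + 2 ≤ Hi i := fun i => by have := hwide i; unfold tanOff at this; omega
  have hyb := hy; rw [Finset.mem_Icc] at hyb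
  -- the exit coordinate `slabPt … i₀` lies in `[Lo+1, Hi−1]`
  have hsl : Lo i₀ + 1 ≤ slabPt Lo Hi 1 (ψ y) i₀ ∧ slabPt Lo Hi 1 (ψ y) i₀ ≤ Hi i₀ - 1 := by
    have := hw2 i₀; have h1 := hyb.1 i₀; have h2 := hyb.2 i₀
    simp only [slabPt, max_def, min_def, Nat.cast_one]; split_ifs <;> constructor <;> omega
  rcases ψ_of_mem_wireFinQ hv with h | ⟨k, hk, h⟩ | ⟨k, hk, h⟩
  · rw [h]; exact hy
  · rw [h, Finset.mem_Icc]
    have hex := (ψ_pathPtQ hq (ℓs := ℓs) (M := M) i₀ (hw2 _) hy k).1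
    have htan := ψ_pathPtQ_tan hq (ℓs := ℓs) (M := M) i₀ (hw2 _) (hwide _) hy hk
    constructor <;> intro i
    · by_cases hi : i = i₀
      · rw [hi, hex]; exact (hsl.1).trans' (by omega)
      · rw [eq_oth_of_ne hi]; exact htan.1
    · by_cases hi : i = i₀
      · rw [hi, hex]; exact hsl.2.trans (by omega)
      · rw [eq_oth_of_ne hi]; exact htan.2.1
  · rw [h, Finset.mem_Icc]
    have hexit := ψ_stemPtQ_exit_mem hq (ℓs := ℓs) (M := M) (hdw i₀) hy hface hk
    have htan := (ψ_stemPtQ_coords hq (ℓs := ℓs) (M := M) i₀ (hw2 _) σ₀ hy k).2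
    have hτ := tanTgt_mem (oth i₀) (hwide (oth i₀)) (ψ y)
    constructor <;> intro i
    · by_cases hi : i = i₀
      · rw [hi]; linarith [hexit.1]
      · rw [eq_oth_of_ne hi, htan]; linarith [hτ.1]
    · by_cases hi : i = i₀
      · rw [hi]; linarith [hexit.2]
      · rw [eq_oth_of_ne hi, htan]; linarith [hτ.2]

/-- The exit datum of a contact is a face datum of its inner neighbour (from `Lip`). [folklore] -/
theorem ctDir_face (hlip : Lip G ψ) {x : V} (hx : x ∈ outerBoundary (winGraph G w₀ R) (Win G ψ w₀ (Finset.Icc Lo Hi) R)) :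
    ((ctDir G ψ w₀ R Lo Hi x).2 = 1 ∧ ψ (ctY G ψ w₀ R Lo Hi x) (ctDir G ψ w₀ R Lo Hi x).1 = Hi (ctDir G ψ w₀ R Lo Hi x).1) ∨
    ((ctDir G ψ w₀ R Lo Hi x).2 = -1 ∧ ψ (ctY G ψ w₀ R Lo Hi x) (ctDir G ψ w₀ R Lo Hi x).1 = Lo (ctDir G ψ w₀ R Lo Hi x).1) :=
  exitDir_spec hlip hx

/-- The inner neighbour of a contact lies in the box. [folklore] -/
theorem ctY_mem_Icc {x : V} (hx : x ∈ outerBoundary (winGraph G w₀ R) (Win G ψ w₀ (Finset.Icc Lo Hi) R)) :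
    ψ (ctY G ψ w₀ R Lo Hi x) ∈ Finset.Icc Lo Hi :=
  (inNbr_spec hx).2.2

/-- The inner neighbour sits at depth `0` behind the exit side. [folklore] -/
theorem sdepth_ctY_eq_zero (hlip : Lip G ψ) {x : V} (hx : x ∈ outerBoundary (winGraph G w₀ R) (Win G ψ w₀ (Finset.Icc Lo Hi) R)) :
    sdepth ψ Lo Hi (ctDir G ψ w₀ R Lo Hi x).1 (ctDir G ψ w₀ R Lo Hi x).2 (ctY G ψ w₀ R Lo Hi x) = 0 := by
  unfold sdepth
  rcases ctDir_face hlip hx with ⟨hs, hc⟩ | ⟨hs, hc⟩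
  · rw [hs, hc]; simp
  · rw [hs, hc]; simp

/-- **The stem end of a contact sits at depth `1 + d`**, with tangential coordinate the clamped target. [folklore] -/
theorem ψ_ctT1 (hlip : Lip G ψ) {P : ApronPrm} (hq : QStepsN G ψ P.N) (hw2 : ∀ i, Lo i + 2 ≤ Hi i) {x : V}
    (hx : x ∈ outerBoundary (winGraph G w₀ R) (Win G ψ w₀ (Finset.Icc Lo Hi) R)) :
    sdepth ψ Lo Hi (ctDir G ψ w₀ R Lo Hi x).1 (ctDir G ψ w₀ R Lo Hi x).2 (ctT1 G ψ P w₀ R Lo Hi x) = 1 + P.d ∧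
      ψ (ctT1 G ψ P w₀ R Lo Hi x) (oth (ctDir G ψ w₀ R Lo Hi x).1) =
        tanTgt Lo Hi P.ℓs P.M (oth (ctDir G ψ w₀ R Lo Hi x).1) (ψ (ctY G ψ w₀ R Lo Hi x)) :=
  ⟨sdepth_stemPtQ hq (hw2 _) (ctY_mem_Icc hx) (ctDir_face hlip hx) P.d,
    (ψ_stemPtQ_coords hq (ℓs := P.ℓs) (M := P.M) _ (hw2 _) _ (ctY_mem_Icc hx) P.d).2⟩

/-- **The wired path of a contact lies in the level box.** [folklore] -/
theorem mem_Icc_of_mem_ctWire (hlip : Lip G ψ) {P : ApronPrm} (hq : QStepsN G ψ P.N) (hwide : ∀ i, Lo i + 2 * tanOff P.ℓs P.M ≤ Hi i)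
    (hdw : ∀ i, Lo i + (P.d + 2 : ℕ) ≤ Hi i) {x : V} (hx : x ∈ outerBoundary (winGraph G w₀ R) (Win G ψ w₀ (Finset.Icc Lo Hi) R)) {v : V}
    (hv : v ∈ ctWire G ψ P w₀ R Lo Hi x) : ψ v ∈ Finset.Icc Lo Hi :=
  mem_Icc_of_mem_wireFinQ hq hwide hdw (ctY_mem_Icc hx) (ctDir_face hlip hx) hv

/-- The stem end is within graph distance `N(T₀ + 1) + N d` of the inner neighbour. [folklore] -/
theorem ctT1_mem_graphBall {P : ApronPrm} (hq : QStepsN G ψ P.N) (hwide : ∀ i, Lo i + 2 * tanOff P.ℓs P.M ≤ Hi i) {x : V}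
    (hx : x ∈ outerBoundary (winGraph G w₀ R) (Win G ψ w₀ (Finset.Icc Lo Hi) R)) :
    ctT1 G ψ P w₀ R Lo Hi x ∈ graphBall G (ctY G ψ w₀ R Lo Hi x) (P.N * (tanOff P.ℓs P.M + 1) + P.N * P.d) := by
  have hyP := ctY_mem_Icc hx
  have hw2 : ∀ i, Lo i + 2 ≤ Hi i := fun i => by have := hwide i; unfold tanOff at this; omega
  have h := stemPtQ_mem_graphBall hq (ℓs := P.ℓs) (M := P.M) (ctDir G ψ w₀ R Lo Hi x).1 (hw2 _) (ctDir G ψ w₀ R Lo Hi x).2 hyP P.d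
  refine graphBall_mono G _ ?_ h
  have hK := pathLen_le (φ := ψ) (ℓs := P.ℓs) (M := P.M) (ctDir G ψ w₀ R Lo Hi x).1 (hwide (oth _)) hyP
  have : P.N * (pathLen ψ Lo Hi P.ℓs P.M (ctDir G ψ w₀ R Lo Hi x).1 (ctY G ψ w₀ R Lo Hi x) + 1) ≤ P.N * (tanOff P.ℓs P.M + 1) :=
    Nat.mul_le_mul_left _ (by omega)
  omega

/-- The wired path is within graph distance `N(T₀ + 2) + N d` of the inner neighbour. [folklore] -/
theorem ctWire_subset_graphBall' {P : ApronPrm} (hq : QStepsN G ψ P.N) (hwide : ∀ i, Lo i + 2 * tanOff P.ℓs P.M ≤ Hi i) {x : V}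
    (hx : x ∈ outerBoundary (winGraph G w₀ R) (Win G ψ w₀ (Finset.Icc Lo Hi) R)) :
    ∀ v ∈ ctWire G ψ P w₀ R Lo Hi x, v ∈ graphBall G (ctY G ψ w₀ R Lo Hi x) (P.N * (tanOff P.ℓs P.M + 2) + P.N * P.d) := by
  intro v hv
  have hyP := ctY_mem_Icc hx
  have hw2 : ∀ i, Lo i + 2 ≤ Hi i := fun i => by have := hwide i; unfold tanOff at this; omega
  have h := wireFinQ_subset_graphBall hq (ℓs := P.ℓs) (M := P.M) (ctDir G ψ w₀ R Lo Hi x).1 (hw2 _) (ctDir G ψ w₀ R Lo Hi x).2 hyP P.d v hv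
  refine graphBall_mono G _ ?_ h
  have hK := pathLen_le (φ := ψ) (ℓs := P.ℓs) (M := P.M) (ctDir G ψ w₀ R Lo Hi x).1 (hwide (oth _)) hyP
  have : P.N * pathLen ψ Lo Hi P.ℓs P.M (ctDir G ψ w₀ R Lo Hi x).1 (ctY G ψ w₀ R Lo Hi x) ≤ P.N * tanOff P.ℓs P.M :=
    Nat.mul_le_mul_left _ hK
  rw [Nat.mul_add]; omega

end Footprints

/-! ## §3 The kit centre and the face -/

section Centre

variable {G} {w₀ : V} {R : ℕ} {Lo Hi : Site 2} (SF : ∀ (i : Fin 2) (σ : ℤˣ), SideForm ψ φ Lo Hi i σ) {P : ApronPrm}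

omit [DecidableEq V] [G.LocallyFinite] in
/-- The kit centre sits over the kit point (under `Steps` of the base chart). [folklore] -/
theorem φ_ctCtr (hstep : Steps G φ) (x : V) :
    φ (ctCtr G SF P w₀ R x) = (SF (ctDir G ψ w₀ R Lo Hi x).1 (ctDir G ψ w₀ R Lo Hi x).2).kitPt (φ (ctT1 G ψ P w₀ R Lo Hi x)) (shellD P) P.A := by
  unfold ctCtr; exact (colPt_spec hstep _ _).2

omit [DecidableEq V] [G.LocallyFinite] in
/-- The kit centre is within graph distance `kitK` of the stem end (under `Steps`). [folklore] -/
theorem ctCtr_mem_graphBall (hstep : Steps G φ) (x : V) :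
    ctCtr G SF P w₀ R x ∈ graphBall G (ctT1 G ψ P w₀ R Lo Hi x)
      ((SF (ctDir G ψ w₀ R Lo Hi x).1 (ctDir G ψ w₀ R Lo Hi x).2).kitK (φ (ctT1 G ψ P w₀ R Lo Hi x)) (shellD P) P.A) := by
  unfold ctCtr
  have h := (colPt_spec hstep (ctT1 G ψ P w₀ R Lo Hi x) ((SF (ctDir G ψ w₀ R Lo Hi x).1 (ctDir G ψ w₀ R Lo Hi x).2).kitPt
    (φ (ctT1 G ψ P w₀ R Lo Hi x)) (shellD P) P.A)).1
  refine graphBall_mono G _ (le_of_eq ?_) h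
  set F := SF (ctDir G ψ w₀ R Lo Hi x).1 (ctDir G ψ w₀ R Lo Hi x).2
  unfold SideForm.kitPt
  by_cases ha : F.a = 0
  · rw [ha]; simp [Int.natAbs_mul]
  · have ha1 : F.a = 1 := by
      rcases Fin.eq_zero_or_eq_succ F.a with h | ⟨k, hk⟩
      · exact absurd h ha
      · rw [hk]; exact congrArg Fin.succ (Fin.eq_zero k)
    rw [ha1]; simp [Int.natAbs_mul]

omit [DecidableEq V] [G.LocallyFinite] in
/-- **The kit centre lies above the shell line by `A`**: `θ D + A ≤ L(φ c)`, provided `L(φ t₁) ≤ θ D + A` (under `Steps`). [this work] -/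
theorem le_lin_ctCtr (hstep : Steps G φ) {x : V}
    (ht : (SF (ctDir G ψ w₀ R Lo Hi x).1 (ctDir G ψ w₀ R Lo Hi x).2).lin (φ (ctT1 G ψ P w₀ R Lo Hi x)) ≤
      (SF (ctDir G ψ w₀ R Lo Hi x).1 (ctDir G ψ w₀ R Lo Hi x).2).θ (shellD P) + P.A) :
    (SF (ctDir G ψ w₀ R Lo Hi x).1 (ctDir G ψ w₀ R Lo Hi x).2).θ (shellD P) + P.A ≤
      (SF (ctDir G ψ w₀ R Lo Hi x).1 (ctDir G ψ w₀ R Lo Hi x).2).lin (φ (ctCtr G SF P w₀ R x)) := by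
  rw [φ_ctCtr SF hstep]; exact SideForm.le_lin_kitPt _ ht

omit [DecidableEq V] [G.LocallyFinite] in
/-- Hence the kit centre is at depth `≥ D` behind the exit side. [folklore] -/
theorem shellD_le_sdepth_ctCtr (hstep : Steps G φ) (hA : 0 ≤ P.A) {x : V}
    (ht : (SF (ctDir G ψ w₀ R Lo Hi x).1 (ctDir G ψ w₀ R Lo Hi x).2).lin (φ (ctT1 G ψ P w₀ R Lo Hi x)) ≤
      (SF (ctDir G ψ w₀ R Lo Hi x).1 (ctDir G ψ w₀ R Lo Hi x).2).θ (shellD P) + P.A) :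
    (shellD P : ℤ) ≤ sdepth ψ Lo Hi (ctDir G ψ w₀ R Lo Hi x).1 (ctDir G ψ w₀ R Lo Hi x).2 (ctCtr G SF P w₀ R x) :=
  (SF _ _).le_sdepth_of_lin (by have := le_lin_ctCtr SF hstep ht; linarith)

variable (Rg : V → Finset V)

/-- The face lies in the pinned short region. [folklore] -/
theorem ctFace_subset_ctQk (x : V) : ctFace G SF Rg P w₀ R x ⊆ ctQk G SF Rg P w₀ R x := Finset.filter_subset _ _

/-- The pinned short region lies in the shell window. [folklore] -/
theorem ctQk_subset_shellWinA (x : V) : ctQk G SF Rg P w₀ R x ⊆ shellWinA G ψ w₀ R Lo Hi P.ℓs := Finset.inter_subset_right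

/-- The pinned short region lies in the short region of the kit centre. [folklore] -/
theorem ctQk_subset_Rg (x : V) : ctQk G SF Rg P w₀ R x ⊆ Rg (ctCtr G SF P w₀ R x) := Finset.inter_subset_left

/-- Every face vertex has a neighbour in the apron. [folklore] -/
theorem exists_adj_of_mem_ctFace {x u : V} (hu : u ∈ ctFace G SF Rg P w₀ R x) : ∃ w ∈ ctApron G SF P w₀ R x, G.Adj w u :=
  (Finset.mem_filter.1 hu).2

/-- A vertex of the pinned short region with a neighbour in the apron is a face vertex. [folklore] -/
theorem mem_ctFace {x u w : V} (hu : u ∈ ctQk G SF Rg P w₀ R x) (hw : w ∈ ctApron G SF P w₀ R x) (hadj : G.Adj w u) :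
    u ∈ ctFace G SF Rg P w₀ R x :=
  Finset.mem_filter.2 ⟨hu, w, hw, hadj⟩

end Centre

end Skelφ

end Summit.CriticalPhenomena.PercolationContinuityZ3.Theorems.Transplant

end
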